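import Summits.KontsevichZagierPeriods.KontsevichZagierPeriods.Theses.HyperbolicBloch
import Summits.KontsevichZagierPeriods.KontsevichZagierPeriods.Theorems.HyperbolicBlochFiveTermTransferStubPrismClass
import Summits.KontsevichZagierPeriods.KontsevichZagierPeriods.Theorems.HyperbolicBlochPachnerTwoThreePointwise
import Summits.KontsevichZagierPeriods.KontsevichZagierPeriods.Theorems.HyperbolicBlochPachnerTwoThreeScaffold
import Literature.NumberTheory.Transcendental.KZIdealTetrahedron

/-!
# `IdealTetraRepExists` (stmt-KontsevichZagierPeriods-3473) — non-vacuity of the 2–3 move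

Support item of route HyperbolicBloch. For the route's verbatim edge form `L u v p` ("left of
`u → v`") and circumsphere form `S u v w p` (positive outside the hemisphere through `u, v, w` for a
counter-clockwise triple), algebraic vertices `u, v, w` in counter-clockwise position and an
algebraic point `q`, BOTH solids of the 2–3 Pachner move carry Kontsevich–Zagier integral
representations with the hyperbolic volume density `t⁻³` as integrand, of KZ's literal rational
shape (`p = 1`, `q = X₂³`):

* the prism `P(u, v, w) = {t > 0, L u v > 0, L v w > 0, L w u > 0, S u v w > 0}` over the triangle
  above its circumhemisphere (`exists_prismRep`): it is the image of the tree's standard ideal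
  tetrahedron `idealTetrahedron z`, `z = (w − u)/(v − u)` (`Im z > 0` ⇔ counter-clockwise), under
  the boundary-fixing similarity `ζ ↦ (v − u) ζ + u`, `t ↦ ‖v − u‖ t` of `ℍ³`, which is ONE
  change-of-variables move of the calculus — this is exactly the landed prism move
  `FiveTerm.prismClass_move` applied to `KZ.idealTetrahedronRep z`; the signed prism of that lemma
  is the plain prism because the orientation factor `L u v ŵ` is positive;
* the inner tetrahedron `(q; u, v, w) = {t > 0, S u v w < 0, S u v q > 0, S v w q > 0, S w u q > 0}`
  for `q̂` strictly inside the triangle (`integrableOn_inner`, `isSemialgebraic_inner`): its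
  defining forms are polynomials in `p` whose coefficients are polynomials in the real and
  imaginary parts of the algebraic vertices, hence `ℚ`-definable (`KZSemialgebraicComplex`), and
  `t⁻³` is integrable on it because, off the Lebesgue-null scaffold
  `{S u v w = 0} ∪ {L u q = 0} ∪ {L v q = 0} ∪ {L w q = 0}` (`PachnerTwoThree.stub_nullScaffold`),
  it lies inside the union of the three small prisms `P(u,v,q) ∪ P(v,w,q) ∪ P(w,u,q)` by the
  pointwise 2–3 identity (`PachnerTwoThree.stub_exchangePointwise`), each of finite volume by the
  first part.

Adapted from the standing disprover's kernel-checked candidate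
`Cruxes/PachnerTwoThree/Disproof.lean` §§5b–6 (refuter-cdisprove, 2026-08-15; attached as item
evidence `IdealTetraRepExistsCandidate.lean`), which a refuter may not land under `Theorems/`;
here the similarity transport and the pointwise identity are taken from the landed stub files
instead of being re-proved.

References: M. Kontsevich, D. Zagier, *Periods* (2001), §1.1 (algebraic parameters, rational
shape); R. Benedetti, C. Petronio, *Lectures on Hyperbolic Geometry* (1992), A.3.5 (similarities of
the upper half-space); J. Bochnak, M. Coste, M.-F. Roy, *Real Algebraic Geometry* (1998),
Prop. 2.2.6; J. Milnor, *Hyperbolic geometry: the first 150 years* (1982), Appendix, Lemma 2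
(finite volume of the ideal tetrahedron).
-/

noncomputable section

open Set MeasureTheory MvPolynomial
open Literature.NumberTheory.Transcendental Literature.ModelTheory.ExponentialFields

namespace Summit.KontsevichZagierPeriods.HyperbolicBloch.IdealTetraRep

open Summit.KontsevichZagierPeriods.HyperbolicBloch.FiveTerm (prismClass_move)
open Summit.KontsevichZagierPeriods.HyperbolicBloch.PachnerTwoThree (stub_exchangePointwise
  stub_nullScaffold)

section Forms

variable {L : ℂ → ℂ → (Fin 3 → ℝ) → ℝ} {S : ℂ → ℂ → ℂ → (Fin 3 → ℝ) → ℝ}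
variable (hL : ∀ u v p, L u v p = (v.re - u.re) * (p 1 - u.im) - (v.im - u.im) * (p 0 - u.re))
  (hS : ∀ u v w p, S u v w p = (p 0 ^ 2 + p 1 ^ 2 + p 2 ^ 2) * (u.re * (v.im - w.im) - u.im * (v.re - w.re) + (v.re * w.im - v.im * w.re)) - p 0 * (Complex.normSq u * (v.im - w.im) - u.im * (Complex.normSq v - Complex.normSq w) + (Complex.normSq v * w.im - v.im * Complex.normSq w)) + p 1 * (Complex.normSq u * (v.re - w.re) - u.re * (Complex.normSq v - Complex.normSq w) + (Complex.normSq v * w.re - v.re * Complex.normSq w)) - (Complex.normSq u * (v.re * w.im - v.im * w.re) - u.re * (Complex.normSq v * w.im - v.im * Complex.normSq w) + u.im * (Complex.normSq v * w.re - v.re * Complex.normSq w)))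

/-! ## §1 The prism: one similarity move away from the standard ideal tetrahedron -/

include hL hS in
/-- **The prism over a counter-clockwise triangle with algebraic vertices is a KZ integral
representation** with integrand `t⁻³`, of rational shape `1 / X₂³`. With `e = b − a ≠ 0` and
`z = (c − a)/(b − a)` (so `Im z = L a b ĉ / ‖b − a‖² > 0` and `z` is algebraic), the prism move
`prismClass_move` (the boundary-fixing similarity `ζ ↦ e ζ + a`, `t ↦ ‖e‖ t`, one
change-of-variables move) carries `KZ.idealTetrahedronRep z` to a representation on the signed
prism `{t > 0, J·L a b > 0, J·L b c > 0, J·L c a > 0, J·S a b c > 0}`, `J = L a b ĉ > 0`, which is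
the plain prism. [cite: KontsevichZagier2001, §1.1; BenedettiPetronio1992, A.3.5] -/
theorem exists_prismRep {a b c : ℂ} (ha : IsAlgebraic ℚ a) (hb : IsAlgebraic ℚ b)
    (hc : IsAlgebraic ℚ c) (hccw : 0 < L a b ![c.re, c.im, 0]) :
    ∃ r : KZ.IntegralRep 3,
      r.domain = {p | 0 < p 2 ∧ 0 < L a b p ∧ 0 < L b c p ∧ 0 < L c a p ∧ 0 < S a b c p} ∧
      EqOn r.integrand (fun p => 1 / p 2 ^ 3) r.domain ∧ r.IsRational := by
  -- the edge vector `b − a` is non-zero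
  have he : b - a ≠ 0 := by
    intro h
    have hba : b = a := sub_eq_zero.mp h
    have h0 : L a b ![c.re, c.im, 0] = 0 := by rw [hL, hba]; ring
    exact hccw.ne' h0
  -- the shape parameter
  set z : ℂ := (c - a) / (b - a) with hz_def
  have hz : IsAlgebraic ℚ z := by
    rw [hz_def, div_eq_mul_inv]
    exact (hc.sub ha).mul (hb.sub ha).inv
  have hzim : 0 < z.im := by
    have hn : 0 < Complex.normSq (b - a) := Complex.normSq_pos.mpr he
    have him : z.im = L a b ![c.re, c.im, 0] / Complex.normSq (b - a) := by
      rw [hz_def, Complex.div_im, div_sub_div_same, hL]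
      congr 1
      simp only [Complex.sub_im, Complex.sub_re, Matrix.cons_val_zero, Matrix.cons_val_one]
      ring
    rw [him]
    exact div_pos hccw hn
  -- the signed prism family of the prism move
  obtain ⟨P, hP⟩ : ∃ P : ℂ → ℂ → ℂ → Set (Fin 3 → ℝ), ∀ u v w, P u v w =
      {p | 0 < p 2 ∧ 0 < L u v ![w.re, w.im, 0] * L u v p ∧ 0 < L u v ![w.re, w.im, 0] * L v w p ∧
        0 < L u v ![w.re, w.im, 0] * L w u p ∧ 0 < L u v ![w.re, w.im, 0] * S u v w p} :=
    ⟨_, fun _ _ _ => rfl⟩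
  obtain ⟨R, hRdom, hRint, -⟩ := prismClass_move L hL S hS P hP (hb.sub ha) ha he z z 1
    (Or.inl rfl) hzim rfl (one_mul _).symm (KZ.idealTetrahedronRep z hz hzim) rfl (fun _ _ => rfl)
  have e1 : b - a + a = b := sub_add_cancel b a
  have e2 : (b - a) * z + a = c := by rw [hz_def, mul_div_cancel₀ _ he, sub_add_cancel]
  rw [e1, e2, hP] at hRdom
  have hdom : R.domain = {p | 0 < p 2 ∧ 0 < L a b p ∧ 0 < L b c p ∧ 0 < L c a p ∧ 0 < S a b c p} := by
    rw [hRdom]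
    ext p
    simp only [mem_setOf_eq, mul_pos_iff_of_pos_left hccw]
  refine ⟨R, hdom, hRint, 1, X 2 ^ 3, fun p hp => ?_, fun p hp => ?_⟩
  · rw [hdom] at hp
    simpa using pow_ne_zero 3 hp.1.ne'
  · show R.integrand p = _
    rw [hRint hp]
    simp

/-! ## §2 The inner tetrahedron: `ℚ`-semialgebraic, and inside three prisms off a null scaffold -/

include hS in
/-- The circumsphere form `S a b c` with algebraic vertices is a `ℚ`-semialgebraic function on
`ℝ³`: it is `(x² + y² + t²)·c₁ − x·c₂ + y·c₃ − c₄` with coefficients `cᵢ` polynomial in the real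
and imaginary parts (and squared norms) of `a, b, c`, which are real algebraic, hence `ℚ`-definable
constants. [cite: KontsevichZagier2001, §1.1; BochnakCosteRoy1998, Prop. 2.2.6] -/
theorem isSemialgebraicFunOn_S {a b c : ℂ} (ha : IsAlgebraic ℚ a) (hb : IsAlgebraic ℚ b)
    (hc : IsAlgebraic ℚ c) : IsSemialgebraicFunOn ℚ (univ : Set (Fin 3 → ℝ)) (S a b c) := by
  have hU : IsSemialgebraic ℚ (univ : Set (Fin 3 → ℝ)) := isSemialgebraic_univ
  have hcoord : ∀ i : Fin 3, IsSemialgebraicFunOn ℚ (univ : Set (Fin 3 → ℝ)) (fun p => p i) :=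
    fun i => (isSemialgebraicFunOn_aeval hU (X i)).congr fun p _ => by simp
  have hP : IsSemialgebraicFunOn ℚ (univ : Set (Fin 3 → ℝ))
      (fun p => p 0 ^ 2 + p 1 ^ 2 + p 2 ^ 2) :=
    (isSemialgebraicFunOn_aeval hU (X 0 ^ 2 + X 1 ^ 2 + X 2 ^ 2)).congr fun p _ => by simp
  obtain ⟨ar, ai⟩ := isAlgebraic_re_im ha
  obtain ⟨br, bi⟩ := isAlgebraic_re_im hb
  obtain ⟨cr, ci⟩ := isAlgebraic_re_im hc
  have na : IsAlgebraic ℚ (Complex.normSq a) := by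
    rw [Complex.normSq_apply]; exact (ar.mul ar).add (ai.mul ai)
  have nb : IsAlgebraic ℚ (Complex.normSq b) := by
    rw [Complex.normSq_apply]; exact (br.mul br).add (bi.mul bi)
  have nc : IsAlgebraic ℚ (Complex.normSq c) := by
    rw [Complex.normSq_apply]; exact (cr.mul cr).add (ci.mul ci)
  have k1 : IsSemialgebraicFunOn ℚ (univ : Set (Fin 3 → ℝ))
      (fun _ => a.re * (b.im - c.im) - a.im * (b.re - c.re) + (b.re * c.im - b.im * c.re)) :=
    isSemialgebraicFunOn_const_of_isAlgebraic hU
      (((ar.mul (bi.sub ci)).sub (ai.mul (br.sub cr))).add ((br.mul ci).sub (bi.mul cr)))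
  have k2 : IsSemialgebraicFunOn ℚ (univ : Set (Fin 3 → ℝ))
      (fun _ => Complex.normSq a * (b.im - c.im) - a.im * (Complex.normSq b - Complex.normSq c) +
        (Complex.normSq b * c.im - b.im * Complex.normSq c)) :=
    isSemialgebraicFunOn_const_of_isAlgebraic hU
      (((na.mul (bi.sub ci)).sub (ai.mul (nb.sub nc))).add ((nb.mul ci).sub (bi.mul nc)))
  have k3 : IsSemialgebraicFunOn ℚ (univ : Set (Fin 3 → ℝ))
      (fun _ => Complex.normSq a * (b.re - c.re) - a.re * (Complex.normSq b - Complex.normSq c) +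
        (Complex.normSq b * c.re - b.re * Complex.normSq c)) :=
    isSemialgebraicFunOn_const_of_isAlgebraic hU
      (((na.mul (br.sub cr)).sub (ar.mul (nb.sub nc))).add ((nb.mul cr).sub (br.mul nc)))
  have k4 : IsSemialgebraicFunOn ℚ (univ : Set (Fin 3 → ℝ))
      (fun _ => Complex.normSq a * (b.re * c.im - b.im * c.re) -
        a.re * (Complex.normSq b * c.im - b.im * Complex.normSq c) +
        a.im * (Complex.normSq b * c.re - b.re * Complex.normSq c)) :=
    isSemialgebraicFunOn_const_of_isAlgebraic hU
      (((na.mul ((br.mul ci).sub (bi.mul cr))).sub (ar.mul ((nb.mul ci).sub (bi.mul nc)))).add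
        (ai.mul ((nb.mul cr).sub (br.mul nc))))
  exact (IsSemialgebraicFunOn.sub_holds (IsSemialgebraicFunOn.add_holds
    (IsSemialgebraicFunOn.sub_holds (IsSemialgebraicFunOn.mul_holds hP k1)
      (IsSemialgebraicFunOn.mul_holds (hcoord 0) k2))
    (IsSemialgebraicFunOn.mul_holds (hcoord 1) k3)) k4).congr fun p _ => by
      simp only [Pi.sub_apply, Pi.add_apply, Pi.mul_apply, hS]

include hS in
/-- **The inner tetrahedron with algebraic vertices is `ℚ`-semialgebraic**: four strict
inequalities between `ℚ`-semialgebraic functions and `t > 0` (graph elimination,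
Tarski–Seidenberg). [cite: BochnakCosteRoy1998, Prop. 2.2.6] -/
theorem isSemialgebraic_inner {a b c d : ℂ} (ha : IsAlgebraic ℚ a) (hb : IsAlgebraic ℚ b)
    (hc : IsAlgebraic ℚ c) (hd : IsAlgebraic ℚ d) :
    IsSemialgebraic ℚ {p : Fin 3 → ℝ | 0 < p 2 ∧ S a b c p < 0 ∧ 0 < S a b d p ∧ 0 < S b c d p ∧
      0 < S c a d p} := by
  have h0 : IsSemialgebraicFunOn ℚ (univ : Set (Fin 3 → ℝ)) (fun _ => (0 : ℝ)) := by
    simpa using isSemialgebraicFunOn_natCast (k := ℚ) (R := ℝ) isSemialgebraic_univ 0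
  have h2 : IsSemialgebraicFunOn ℚ (univ : Set (Fin 3 → ℝ)) (fun p => p 2) :=
    (isSemialgebraicFunOn_aeval isSemialgebraic_univ (X 2)).congr fun p _ => by simp
  have e : {p : Fin 3 → ℝ | 0 < p 2 ∧ S a b c p < 0 ∧ 0 < S a b d p ∧ 0 < S b c d p ∧
      0 < S c a d p} = {p : Fin 3 → ℝ | (0 : ℝ) < p 2} ∩ ({p | S a b c p < (0 : ℝ)} ∩
      ({p | (0 : ℝ) < S a b d p} ∩ ({p | (0 : ℝ) < S b c d p} ∩ {p | (0 : ℝ) < S c a d p}))) := by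
    ext p; simp
  rw [e]
  exact (isSemialgebraic_setOf_lt_of_isSemialgebraicFunOn h0 h2).inter
    ((isSemialgebraic_setOf_lt_of_isSemialgebraicFunOn (isSemialgebraicFunOn_S hS ha hb hc) h0).inter
    ((isSemialgebraic_setOf_lt_of_isSemialgebraicFunOn h0 (isSemialgebraicFunOn_S hS ha hb hd)).inter
    ((isSemialgebraic_setOf_lt_of_isSemialgebraicFunOn h0 (isSemialgebraicFunOn_S hS hb hc hd)).inter
    (isSemialgebraic_setOf_lt_of_isSemialgebraicFunOn h0 (isSemialgebraicFunOn_S hS hc ha hd)))))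

include hL hS in
/-- **Finite volume of the inner tetrahedron.** For `q̂` strictly inside the counter-clockwise
triangle `(u, v, w)` (algebraic vertices), `t⁻³` is absolutely integrable on the inner tetrahedron
`(q; u, v, w)`: off the null scaffold `{S u v w = 0} ∪ {L u q = 0} ∪ {L v q = 0} ∪ {L w q = 0}`
it lies in `P(u,v,q) ∪ P(v,w,q) ∪ P(w,u,q)` (pointwise 2–3 identity), three prisms of finite
volume. [cite: Milnor1982, Appendix, Lemma 2; KontsevichZagier2001, §1.2 rule (1a)] -/
theorem integrableOn_inner {u v w q : ℂ} (hu : IsAlgebraic ℚ u) (hv : IsAlgebraic ℚ v)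
    (hw : IsAlgebraic ℚ w) (hq : IsAlgebraic ℚ q) (h1 : 0 < L u v ![q.re, q.im, 0])
    (h2 : 0 < L v w ![q.re, q.im, 0]) (h3 : 0 < L w u ![q.re, q.im, 0]) :
    IntegrableOn (fun p : Fin 3 → ℝ => 1 / p 2 ^ 3)
      {p | 0 < p 2 ∧ S u v w p < 0 ∧ 0 < S u v q p ∧ 0 < S v w q p ∧ 0 < S w u q p} := by
  -- every counter-clockwise prism with algebraic vertices has finite volume (§1)
  have hP : ∀ {a b c : ℂ}, IsAlgebraic ℚ a → IsAlgebraic ℚ b → IsAlgebraic ℚ c →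
      0 < L a b ![c.re, c.im, 0] → IntegrableOn (fun p : Fin 3 → ℝ => 1 / p 2 ^ 3)
        {p | 0 < p 2 ∧ 0 < L a b p ∧ 0 < L b c p ∧ 0 < L c a p ∧ 0 < S a b c p} := by
    intro a b c ha hb hc habc
    obtain ⟨r, hdom, hint, -⟩ := exists_prismRep hL hS ha hb hc habc
    rw [← hdom]
    exact r.integrableOn.congr_fun hint (KZ.IntegralRep.measurableSet_domain_holds r)
  -- the null scaffold
  set Z : Set (Fin 3 → ℝ) := {p | S u v w p = 0 ∨ L u q p = 0 ∨ L v q p = 0 ∨ L w q p = 0}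
    with hZ_def
  have hZ : volume Z = 0 := stub_nullScaffold L hL S hS u v w q h1 h2 h3
  -- the inner tetrahedron lies in the three small prisms off the scaffold
  have hsub : {p : Fin 3 → ℝ | 0 < p 2 ∧ S u v w p < 0 ∧ 0 < S u v q p ∧ 0 < S v w q p ∧
      0 < S w u q p} ⊆
      ({p | 0 < p 2 ∧ 0 < L u v p ∧ 0 < L v q p ∧ 0 < L q u p ∧ 0 < S u v q p} ∪
        {p | 0 < p 2 ∧ 0 < L v w p ∧ 0 < L w q p ∧ 0 < L q v p ∧ 0 < S v w q p} ∪
        {p | 0 < p 2 ∧ 0 < L w u p ∧ 0 < L u q p ∧ 0 < L q w p ∧ 0 < S w u q p}) ∪ Z := by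
    intro p hp
    by_cases hz : p ∈ Z
    · exact Or.inr hz
    · left
      simp only [hZ_def, mem_setOf_eq, not_or] at hz
      rcases (stub_exchangePointwise L hL S hS u v w q h1 h2 h3 p hz.1 hz.2.1 hz.2.2.1
        hz.2.2.2).mp (Or.inr hp) with h | h | h
      · exact Or.inl (Or.inl h)
      · exact Or.inl (Or.inr h)
      · exact Or.inr h
  have hnull : IntegrableOn (fun p : Fin 3 → ℝ => 1 / p 2 ^ 3) Z := by
    rw [IntegrableOn, Measure.restrict_eq_zero.mpr hZ]
    exact integrable_zero_measure
  exact ((((hP hu hv hq h1).union (hP hv hw hq h2)).union (hP hw hu hq h3)).union hnull).mono_set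
    hsub

end Forms

/-! ## §3 The item -/

/-- **`IdealTetraRepExists` holds** (stmt-KontsevichZagierPeriods-3473, route HyperbolicBloch):
for algebraic `u, v, w` in counter-clockwise position and algebraic `q`, the prism `P(u, v, w)`
carries a KZ integral representation with integrand `t⁻³` of rational shape `1 / X₂³`
(`exists_prismRep`), and so does the inner tetrahedron `(q; u, v, w)` when `q̂` is strictly inside
the triangle (`isSemialgebraic_inner`, `integrableOn_inner`, and `t⁻³ = 1 / X₂³` is a
`ℚ`-rational function non-singular on `{t > 0}`). [cite: KontsevichZagier2001, §1.1] -/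
theorem idealTetraRepExists_proof :
    Summit.KontsevichZagierPeriods.KontsevichZagierPeriods.Theses.HyperbolicBloch.IdealTetraRepExists := by
  unfold Summit.KontsevichZagierPeriods.KontsevichZagierPeriods.Theses.HyperbolicBloch.IdealTetraRepExists
  intro L hL S hS u v w q hu hv hw hq hccw
  refine ⟨exists_prismRep hL hS hu hv hw hccw, fun h1 h2 h3 => ?_⟩
  have hD : IsSemialgebraic ℚ {p : Fin 3 → ℝ | 0 < p 2 ∧ S u v w p < 0 ∧ 0 < S u v q p ∧
      0 < S v w q p ∧ 0 < S w u q p} :=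
    isSemialgebraic_inner hS hu hv hw hq
  have hpos : {p : Fin 3 → ℝ | 0 < p 2 ∧ S u v w p < 0 ∧ 0 < S u v q p ∧ 0 < S v w q p ∧
      0 < S w u q p} ⊆ {p | 0 < p 2} := fun _ hp => hp.1
  refine ⟨⟨_, fun p => 1 / p 2 ^ 3, hD, isSemialgebraicFunOn_one_div_cube hD hpos,
    integrableOn_inner hL hS hu hv hw hq h1 h2 h3⟩, rfl, fun _ _ => rfl, 1, X 2 ^ 3,
    fun p hp => ?_, fun p _ => by simp⟩
  simpa using pow_ne_zero 3 (show (0 : ℝ) < p 2 from hpos hp).ne'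

end Summit.KontsevichZagierPeriods.HyperbolicBloch.IdealTetraRep

end
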